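import Summits.MatrixMultiplication.OmegaCensus.STPPVosperSlackTwoCheckersG
import Summits.MatrixMultiplication.OmegaCensus.STPPVosperSlackFourTablesZ61P3
import Summits.MatrixMultiplication.OmegaCensus.STPPVosperSlackTwoLawABQ

/-!
# ω-census (abelian STPP census): fifth leaf ℤ₆₁ {(2,2,2),(3,3,3)²} (slack 4) — cells δ₁ = 1 / δ₂′ = 1: `caseGDeadT` rows, part 6 of 6 (kernel computations)

HONEST FRAMING (pub-omega census; verbatim): lottery ticket; floor = certified bounds/negative ranges.
Census STRUCTURE (seat pub-omega-stpp-2 gen 27 — rows service for the stpp-1 lineage's slack-4 law, 2026-08-29), family (b2).  Rows `rowsA1` (= `rowsB1` by the leaf's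
role symmetry) of stpp-1 g33's `no_isSTPP_of_slack_four_tables_of_cell22` (`STPPVosperSlackFourLawT.lean`): the Hamidoune–Rødseth cells — `Aᵢ = [0,3] ∖ {h'}`,
`Y° = 3 + ([0,13] ∖ {k})`, pinned-sumset checker `caseGDeadT` (`STPPVosperSlackTwoCheckersG.lean`, required `|SY| = 16` else vacuous), dead table `tblZ61F5A1`
(`STPPVosperSlackFourTablesZ61P3.lean`) — one theorem per hole pair `(h', k)`, each ONE `decide +kernel` over all 1 770 three-shapes with the dihedral filter
(310 representatives; 16 of the 39 pairs are live, 9.5k–33k mirror nodes each, stpp-1 g33 gen_tables61.py).  Assembly in `…F5A1Asm.lean`.  Nothing here is progress on `ω`.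
-/

namespace Summit.MatrixMultiplication.OmegaCensus.CubeNB.S2

/-- Hole pair `(h', k) = (3, 12)` (live: |SY| = 16): kernel row. [folklore] -/
theorem rows61F5A1_h3_k12_all : ((qShapes 61 3 0 1770).all fun Q => dihedralSmaller 61 Q || caseGDeadT 61 3 13 (3 + 13) ((List.range (3 + 1)).filter fun x => !(Nat.beq x 3)) (((List.range (13 + 1)).filter fun x => !(Nat.beq x 12)).map fun m => 3 + m) Q tblZ61F5A1) = true := by
  decide +kernel

/-- Hole pair `(h', k) = (3, 12)` in the law's literal form. [folklore] -/
theorem rows61F5A1_h3_k12 : ∀ Q ∈ qShapes 61 3 0 ((61 - 1).choose (3 - 1)), dihedralSmaller 61 Q = true ∨ caseGDeadT 61 3 13 (3 + 13) ((List.range (3 + 1)).filter fun x => !(Nat.beq x 3)) (((List.range (13 + 1)).filter fun x => !(Nat.beq x 12)).map fun m => 3 + m) Q tblZ61F5A1 = true := by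
  have e : (61 - 1).choose (3 - 1) = 1770 := by decide
  rw [e]
  exact rowsQ_of_all rows61F5A1_h3_k12_all

/-- Hole pair `(h', k) = (3, 13)` (vacuous after the |SY| test): kernel row. [folklore] -/
theorem rows61F5A1_h3_k13_all : ((qShapes 61 3 0 1770).all fun Q => dihedralSmaller 61 Q || caseGDeadT 61 3 13 (3 + 13) ((List.range (3 + 1)).filter fun x => !(Nat.beq x 3)) (((List.range (13 + 1)).filter fun x => !(Nat.beq x 13)).map fun m => 3 + m) Q tblZ61F5A1) = true := by
  decide +kernel

/-- Hole pair `(h', k) = (3, 13)` in the law's literal form. [folklore] -/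
theorem rows61F5A1_h3_k13 : ∀ Q ∈ qShapes 61 3 0 ((61 - 1).choose (3 - 1)), dihedralSmaller 61 Q = true ∨ caseGDeadT 61 3 13 (3 + 13) ((List.range (3 + 1)).filter fun x => !(Nat.beq x 3)) (((List.range (13 + 1)).filter fun x => !(Nat.beq x 13)).map fun m => 3 + m) Q tblZ61F5A1 = true := by
  have e : (61 - 1).choose (3 - 1) = 1770 := by decide
  rw [e]
  exact rowsQ_of_all rows61F5A1_h3_k13_all

end Summit.MatrixMultiplication.OmegaCensus.CubeNB.S2
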